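import Mathlib
import HarnessLib

/-!
# The secular equation of a bordered `3 × 3` Hermitian matrix
# (elementary replacement for Duistermaat–Heckman / Weyl integration in Zhang–Jiang–Xie 2025,
# Prop. 6.10: step B of the "secular peeling" of the two-qubit `λ_max ≤ ½` fibre volume)

Fix real `ε₁ ≠ ε₂`. For `w₁, w₂ ∈ ℂ`, `d ∈ ℝ`, the bordered Hermitian matrix
`H = [[ε₁, 0, w₁], [0, ε₂, w₂], [w̄₁, w̄₂, d]]` has characteristic polynomial
`(X − ε₁)(X − ε₂)(X − d) − |w₁|²(X − ε₂) − |w₂|²(X − ε₁)` (`charpoly_bordered`), the classical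
*secular equation*. Conversely, a triple `e = (e₀, e₁, e₂)` determines *secular coordinates*
`t₁(e) = (e₀−ε₁)(ε₁−e₁)(ε₁−e₂)/(ε₁−ε₂)`, `t₂(e) = (e₀−ε₂)(e₁−ε₂)(ε₂−e₂)/(ε₁−ε₂)`,
`d(e) = e₀+e₁+e₂−ε₁−ε₂` (`secT₁`, `secT₂`, `secD`) with
`(X − ε₁)(X − ε₂)(X − d(e)) − t₁(e)(X − ε₂) − t₂(e)(X − ε₁) = ∏ᵢ (X − eᵢ)` (`secular_identity`), so that
the bordered matrix with `|wᵢ|² = tᵢ(e)`, `d = d(e)` has spectrum `e`: for a strictly decreasing `e`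
its sorted eigenvalue vector `eigenvalues₀` IS `e` (`eigenvalues₀_bordered`). On the interlacing
chamber `e₀ > ε₁ > e₁ > ε₂ > e₂` the secular coordinates are positive (`secT₁_pos`, `secT₂_pos`).

This is the algebraic half of the change of variables `(|w₁|², |w₂|², d) ↔ e` (Jacobian
`Δ(e)/(ε₁ − ε₂)`, in the sequel) by which the Hilbert–Schmidt volume of
`{ρ ∈ Herm₄ : 0 ≼ ρ ≼ ½}` sliced along a diagonal functional is computed WITHOUT Haar measure or the
Duistermaat–Heckman theorem used in the source [ZhangJiangXie2025, §6.2, Prop. 6.10]; it is the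
`3 × 3` instance of the rank-one/bordering ("Rayleigh", Gelfand–Tsetlin) parametrisation of
Hermitian matrices. Everything here is folklore linear algebra; no named facts.

## References

* [ZhangJiangXie2025] L. Zhang, X. Jiang, B. Xie, Quantum Inf. Comput. 25 (2025) 598–632 =
  arXiv:2507.02369, §6.2 Prop. 6.10 (the statement this serves; its printed proof is the
  Duistermaat–Heckman route).
-/

noncomputable section

open Polynomial Complex Matrix
open scoped ComplexConjugate

namespace Literature.Probability.RandomMatrix

namespace ZhangJiangXie2025

/-! ## S1. The bordered matrix and its characteristic polynomial -/

/-- The bordered Hermitian matrix `H(ε₁, ε₂; w₁, w₂; d) = [[ε₁, 0, w₁], [0, ε₂, w₂], [w̄₁, w̄₂, d]]`.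
[folklore] -/
def bordered (ε₁ ε₂ : ℝ) (w₁ w₂ : ℂ) (d : ℝ) : Matrix (Fin 3) (Fin 3) ℂ :=
  !![(ε₁ : ℂ), 0, w₁; 0, (ε₂ : ℂ), w₂; conj w₁, conj w₂, (d : ℂ)]

/-- The bordered matrix is Hermitian. [folklore] -/
theorem isHermitian_bordered (ε₁ ε₂ : ℝ) (w₁ w₂ : ℂ) (d : ℝ) :
    (bordered ε₁ ε₂ w₁ w₂ d).IsHermitian := by
  refine Matrix.IsHermitian.ext fun i j => ?_
  fin_cases i <;> fin_cases j <;> simp [bordered, Complex.conj_ofReal]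

/-- **The secular form of the characteristic polynomial** of the bordered matrix:
`χ_H = (X − ε₁)(X − ε₂)(X − d) − |w₁|²(X − ε₂) − |w₂|²(X − ε₁)`. [folklore] -/
theorem charpoly_bordered (ε₁ ε₂ : ℝ) (w₁ w₂ : ℂ) (d : ℝ) :
    (bordered ε₁ ε₂ w₁ w₂ d).charpoly =
      (X - C (ε₁ : ℂ)) * (X - C (ε₂ : ℂ)) * (X - C (d : ℂ)) -
        C ((normSq w₁ : ℝ) : ℂ) * (X - C (ε₂ : ℂ)) - C ((normSq w₂ : ℝ) : ℂ) * (X - C (ε₁ : ℂ)) := by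
  have h₁ : C (conj w₁) * C w₁ = C ((normSq w₁ : ℝ) : ℂ) := by
    rw [← C_mul, Complex.normSq_eq_conj_mul_self]
  have h₂ : C (conj w₂) * C w₂ = C ((normSq w₂ : ℝ) : ℂ) := by
    rw [← C_mul, Complex.normSq_eq_conj_mul_self]
  rw [Matrix.charpoly, Matrix.det_fin_three]
  simp only [charmatrix_apply, bordered, Matrix.of_apply, Matrix.cons_val', Matrix.cons_val_zero,
    Matrix.cons_val_one, Matrix.cons_val_two, Matrix.empty_val', Matrix.cons_val_fin_one,
    Matrix.diagonal_apply_eq, Matrix.diagonal_apply_ne, Matrix.vecHead, Matrix.vecTail,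
    Function.comp_apply, Fin.succ_zero_eq_one, ne_eq, Fin.reduceEq, not_false_eq_true, map_zero,
    sub_zero]
  linear_combination (-(X - C (ε₂ : ℂ))) * h₁ - (X - C (ε₁ : ℂ)) * h₂

/-! ## S2. Secular coordinates of a spectrum -/

/-- `t₁(e) = (e₀ − ε₁)(ε₁ − e₁)(ε₁ − e₂)/(ε₁ − ε₂)`: the squared modulus `|w₁|²` of the bordered
matrix with spectrum `e`. [folklore] -/
def secT₁ (ε₁ ε₂ : ℝ) (e : Fin 3 → ℝ) : ℝ :=
  (e 0 - ε₁) * (ε₁ - e 1) * (ε₁ - e 2) / (ε₁ - ε₂)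

/-- `t₂(e) = (e₀ − ε₂)(e₁ − ε₂)(ε₂ − e₂)/(ε₁ − ε₂)`: the squared modulus `|w₂|²`. [folklore] -/
def secT₂ (ε₁ ε₂ : ℝ) (e : Fin 3 → ℝ) : ℝ :=
  (e 0 - ε₂) * (e 1 - ε₂) * (ε₂ - e 2) / (ε₁ - ε₂)

/-- `d(e) = e₀ + e₁ + e₂ − ε₁ − ε₂`: the corner entry (trace condition). [folklore] -/
def secD (ε₁ ε₂ : ℝ) (e : Fin 3 → ℝ) : ℝ :=
  e 0 + e 1 + e 2 - ε₁ - ε₂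

/-- **The secular identity**:
`(X − ε₁)(X − ε₂)(X − d(e)) − t₁(e)(X − ε₂) − t₂(e)(X − ε₁) = (X − e₀)(X − e₁)(X − e₂)`. [folklore] -/
theorem secular_identity {ε₁ ε₂ : ℝ} (h : ε₁ ≠ ε₂) (e : Fin 3 → ℝ) :
    (X - C (ε₁ : ℂ)) * (X - C (ε₂ : ℂ)) * (X - C ((secD ε₁ ε₂ e : ℝ) : ℂ)) -
        C ((secT₁ ε₁ ε₂ e : ℝ) : ℂ) * (X - C (ε₂ : ℂ)) -
        C ((secT₂ ε₁ ε₂ e : ℝ) : ℂ) * (X - C (ε₁ : ℂ)) =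
      ∏ i : Fin 3, (X - C ((e i : ℝ) : ℂ)) := by
  have h12 : ((ε₁ - ε₂ : ℝ) : ℂ) ≠ 0 := by exact_mod_cast sub_ne_zero.mpr h
  have h12' : (ε₁ : ℂ) - (ε₂ : ℂ) ≠ 0 := by exact_mod_cast sub_ne_zero.mpr h
  have hC : (C ((ε₁ - ε₂ : ℝ) : ℂ)) ≠ 0 := by rwa [Ne, Polynomial.C_eq_zero]
  apply mul_left_cancel₀ hC
  have k₁ : C ((ε₁ - ε₂ : ℝ) : ℂ) * C ((secT₁ ε₁ ε₂ e : ℝ) : ℂ) =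
      (C ((e 0 : ℝ) : ℂ) - C (ε₁ : ℂ)) * (C (ε₁ : ℂ) - C ((e 1 : ℝ) : ℂ)) *
        (C (ε₁ : ℂ) - C ((e 2 : ℝ) : ℂ)) := by
    simp only [← C_mul, ← C_sub, secT₁]
    congr 1
    push_cast
    rw [mul_div_assoc', mul_comm, mul_div_assoc, div_self h12', mul_one]
  have k₂ : C ((ε₁ - ε₂ : ℝ) : ℂ) * C ((secT₂ ε₁ ε₂ e : ℝ) : ℂ) =
      (C ((e 0 : ℝ) : ℂ) - C (ε₂ : ℂ)) * (C ((e 1 : ℝ) : ℂ) - C (ε₂ : ℂ)) *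
        (C (ε₂ : ℂ) - C ((e 2 : ℝ) : ℂ)) := by
    simp only [← C_mul, ← C_sub, secT₂]
    congr 1
    push_cast
    rw [mul_div_assoc', mul_comm, mul_div_assoc, div_self h12', mul_one]
  have k₃ : C ((secD ε₁ ε₂ e : ℝ) : ℂ) =
      C ((e 0 : ℝ) : ℂ) + C ((e 1 : ℝ) : ℂ) + C ((e 2 : ℝ) : ℂ) - C (ε₁ : ℂ) - C (ε₂ : ℂ) := by
    simp only [← C_add, ← C_sub, secD]
    push_cast
    ring
  have k₀ : C ((ε₁ - ε₂ : ℝ) : ℂ) = C (ε₁ : ℂ) - C (ε₂ : ℂ) := by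
    rw [← C_sub]; push_cast; ring
  simp only [Fin.prod_univ_three]
  linear_combination (-(X - C (ε₂ : ℂ))) * k₁ + (-(X - C (ε₁ : ℂ))) * k₂ +
    (-(C ((ε₁ - ε₂ : ℝ) : ℂ)) * (X - C (ε₁ : ℂ)) * (X - C (ε₂ : ℂ))) * k₃ +
    ((X - C (ε₁ : ℂ)) * (X - C (ε₂ : ℂ)) *
        (X - (C ((e 0 : ℝ) : ℂ) + C ((e 1 : ℝ) : ℂ) + C ((e 2 : ℝ) : ℂ)) + C (ε₁ : ℂ) + C (ε₂ : ℂ)) -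
      (X - C ((e 0 : ℝ) : ℂ)) * (X - C ((e 1 : ℝ) : ℂ)) * (X - C ((e 2 : ℝ) : ℂ))) * k₀

/-- With `|wᵢ|² = tᵢ(e)` and `d = d(e)`, the bordered matrix has characteristic polynomial
`∏ᵢ (X − eᵢ)`. [folklore] -/
theorem charpoly_bordered_of_sec {ε₁ ε₂ : ℝ} (h : ε₁ ≠ ε₂) (e : Fin 3 → ℝ) {w₁ w₂ : ℂ}
    (hw₁ : normSq w₁ = secT₁ ε₁ ε₂ e) (hw₂ : normSq w₂ = secT₂ ε₁ ε₂ e) :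
    (bordered ε₁ ε₂ w₁ w₂ (secD ε₁ ε₂ e)).charpoly = ∏ i : Fin 3, (X - C ((e i : ℝ) : ℂ)) := by
  rw [charpoly_bordered, hw₁, hw₂, secular_identity h e]

/-! ## S3. The spectrum of the bordered matrix -/

/-- **Spectrum of the bordered matrix.** If `e₀ > e₁ > e₂` and `|wᵢ|² = tᵢ(e)`, `d = d(e)`, then the
decreasingly sorted eigenvalues of `H(ε₁, ε₂; w₁, w₂; d)` are `e₀, e₁, e₂`. [folklore] -/
theorem eigenvalues₀_bordered {ε₁ ε₂ : ℝ} (h : ε₁ ≠ ε₂) {e : Fin 3 → ℝ} (he : StrictAnti e)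
    {w₁ w₂ : ℂ} (hw₁ : normSq w₁ = secT₁ ε₁ ε₂ e) (hw₂ : normSq w₂ = secT₂ ε₁ ε₂ e) :
    (isHermitian_bordered ε₁ ε₂ w₁ w₂ (secD ε₁ ε₂ e)).eigenvalues₀ = fun i => e (i.cast (by simp)) := by
  set hH := isHermitian_bordered ε₁ ε₂ w₁ w₂ (secD ε₁ ε₂ e)
  have hsort := hH.sort_roots_charpoly_eq_eigenvalues₀
  have hroots : (bordered ε₁ ε₂ w₁ w₂ (secD ε₁ ε₂ e)).charpoly.roots =
      Finset.univ.val.map fun i : Fin 3 => ((e i : ℝ) : ℂ) := by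
    rw [charpoly_bordered_of_sec h e hw₁ hw₂, Finset.prod_eq_multiset_prod,
      show Finset.univ.val.map (fun i : Fin 3 => X - C ((e i : ℝ) : ℂ)) =
        (Finset.univ.val.map fun i : Fin 3 => ((e i : ℝ) : ℂ)).map (fun a => X - C a) by
          rw [Multiset.map_map]; rfl,
      Polynomial.roots_multiset_prod_X_sub_C]
  rw [hroots, Fin.univ_val_map, Multiset.map_coe, List.map_ofFn] at hsort
  have hre : (RCLike.re ∘ fun i : Fin 3 => ((e i : ℝ) : ℂ)) = e := by
    funext i; simp
  rw [hre, Multiset.coe_sort] at hsort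
  have hms : (List.ofFn e).mergeSort (fun x₁ x₂ => decide (x₁ ≥ x₂)) = List.ofFn e :=
    List.mergeSort_eq_self (r := fun x₁ x₂ => x₁ ≥ x₂)
      (List.pairwise_ofFn.mpr fun i j hij => (he hij).le)
  rw [hms] at hsort
  -- `hsort : List.ofFn e = List.ofFn hH.eigenvalues₀`
  funext i
  have hi : (i : ℕ) < (List.ofFn hH.eigenvalues₀).length := by
    simpa using i.isLt
  have hget := List.getElem_of_eq hsort.symm hi
  simp only [List.getElem_ofFn] at hget
  rw [hget]
  rfl

/-! ## S4. The interlacing chamber -/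

/-- The (open) interlacing chamber `e₀ > ε₁ > e₁ > ε₂ > e₂`. [folklore] -/
def secChamber (ε₁ ε₂ : ℝ) : Set (Fin 3 → ℝ) :=
  {e | ε₁ < e 0 ∧ e 1 < ε₁ ∧ ε₂ < e 1 ∧ e 2 < ε₂}

/-- On the chamber, `t₁(e) > 0`. [folklore] -/
theorem secT₁_pos {ε₁ ε₂ : ℝ} {e : Fin 3 → ℝ} (he : e ∈ secChamber ε₁ ε₂) :
    0 < secT₁ ε₁ ε₂ e := by
  obtain ⟨h0, h1, h2, h3⟩ := he
  unfold secT₁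
  have : 0 < ε₁ - ε₂ := by linarith
  apply div_pos _ this
  have a : 0 < e 0 - ε₁ := by linarith
  have b : 0 < ε₁ - e 1 := by linarith
  have c : 0 < ε₁ - e 2 := by linarith
  positivity

/-- On the chamber, `t₂(e) > 0`. [folklore] -/
theorem secT₂_pos {ε₁ ε₂ : ℝ} {e : Fin 3 → ℝ} (he : e ∈ secChamber ε₁ ε₂) :
    0 < secT₂ ε₁ ε₂ e := by
  obtain ⟨h0, h1, h2, h3⟩ := he
  unfold secT₂
  have : 0 < ε₁ - ε₂ := by linarith
  apply div_pos _ this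
  have a : 0 < e 0 - ε₂ := by linarith
  have b : 0 < e 1 - ε₂ := by linarith
  have c : 0 < ε₂ - e 2 := by linarith
  positivity

/-- On the chamber, `e` is strictly decreasing. [folklore] -/
theorem strictAnti_of_mem_secChamber {ε₁ ε₂ : ℝ} {e : Fin 3 → ℝ} (he : e ∈ secChamber ε₁ ε₂) :
    StrictAnti e := by
  obtain ⟨h0, h1, h2, h3⟩ := he
  intro i j hij
  fin_cases i <;> fin_cases j <;> simp at hij ⊢ <;> linarith

/-! ## S5. The secular map and its Jacobian -/

/-- The secular map `Θ(e) = (t₁(e), t₂(e), d(e))`. [folklore] -/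
def secMap (ε₁ ε₂ : ℝ) (e : Fin 3 → ℝ) : Fin 3 → ℝ :=
  ![secT₁ ε₁ ε₂ e, secT₂ ε₁ ε₂ e, secD ε₁ ε₂ e]

/-- Component `0` of `Θ` is `t₁`. [folklore] -/
@[simp] theorem secMap_zero (ε₁ ε₂ : ℝ) (e : Fin 3 → ℝ) : secMap ε₁ ε₂ e 0 = secT₁ ε₁ ε₂ e := rfl
/-- Component `1` of `Θ` is `t₂`. [folklore] -/
@[simp] theorem secMap_one (ε₁ ε₂ : ℝ) (e : Fin 3 → ℝ) : secMap ε₁ ε₂ e 1 = secT₂ ε₁ ε₂ e := rfl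
/-- Component `2` of `Θ` is `d`. [folklore] -/
@[simp] theorem secMap_two (ε₁ ε₂ : ℝ) (e : Fin 3 → ℝ) : secMap ε₁ ε₂ e 2 = secD ε₁ ε₂ e := rfl

/-- The Jacobian matrix `∂(t₁, t₂, d)/∂(e₀, e₁, e₂)`. [folklore] -/
def secJac (ε₁ ε₂ : ℝ) (e : Fin 3 → ℝ) : Matrix (Fin 3) (Fin 3) ℝ :=
  !![(ε₁ - e 1) * (ε₁ - e 2) / (ε₁ - ε₂), -((e 0 - ε₁) * (ε₁ - e 2)) / (ε₁ - ε₂),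
      -((e 0 - ε₁) * (ε₁ - e 1)) / (ε₁ - ε₂);
    (e 1 - ε₂) * (ε₂ - e 2) / (ε₁ - ε₂), (e 0 - ε₂) * (ε₂ - e 2) / (ε₁ - ε₂),
      -((e 0 - ε₂) * (e 1 - ε₂)) / (ε₁ - ε₂);
    1, 1, 1]

/-- **The Jacobian determinant is the Vandermonde ratio** `Δ(e)/(ε₁ − ε₂)`. [folklore] -/
theorem det_secJac {ε₁ ε₂ : ℝ} (h : ε₁ ≠ ε₂) (e : Fin 3 → ℝ) :
    (secJac ε₁ ε₂ e).det = (e 0 - e 1) * (e 0 - e 2) * (e 1 - e 2) / (ε₁ - ε₂) := by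
  have h12 : ε₁ - ε₂ ≠ 0 := sub_ne_zero.mpr h
  rw [Matrix.det_fin_three]
  simp [secJac]
  field_simp
  ring

/-- The derivative of the secular map, as a continuous linear map. [folklore] -/
def secDeriv (ε₁ ε₂ : ℝ) (e : Fin 3 → ℝ) : (Fin 3 → ℝ) →L[ℝ] (Fin 3 → ℝ) :=
  LinearMap.toContinuousLinearMap (Matrix.toLin' (secJac ε₁ ε₂ e))

/-- `DΘ(e) v = J(e) v`. [folklore] -/
theorem secDeriv_apply (ε₁ ε₂ : ℝ) (e v : Fin 3 → ℝ) :
    secDeriv ε₁ ε₂ e v = (secJac ε₁ ε₂ e).mulVec v := by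
  simp [secDeriv, Matrix.toLin'_apply]

/-- `det(DΘ) = Δ(e)/(ε₁ − ε₂)`. [folklore] -/
theorem det_secDeriv {ε₁ ε₂ : ℝ} (h : ε₁ ≠ ε₂) (e : Fin 3 → ℝ) :
    (secDeriv ε₁ ε₂ e).det = (e 0 - e 1) * (e 0 - e 2) * (e 1 - e 2) / (ε₁ - ε₂) := by
  rw [← det_secJac h e, secDeriv, ContinuousLinearMap.det, LinearMap.coe_toContinuousLinearMap,
    LinearMap.det_toLin']

/-- The coordinate functionals. [folklore] -/
theorem hasFDerivAt_coord (i : Fin 3) (e : Fin 3 → ℝ) :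
    HasFDerivAt (fun e : Fin 3 → ℝ => e i)
      (ContinuousLinearMap.proj (R := ℝ) (φ := fun _ : Fin 3 => ℝ) i) e :=
  hasFDerivAt_apply i e

/-- Derivative of `t₁`. [folklore] -/
theorem hasFDerivAt_secT₁ (ε₁ ε₂ : ℝ) (e : Fin 3 → ℝ) :
    HasFDerivAt (secT₁ ε₁ ε₂) ((ContinuousLinearMap.proj 0).comp (secDeriv ε₁ ε₂ e)) e := by
  have h0 := (hasFDerivAt_coord 0 e).sub_const ε₁
  have h1 := (hasFDerivAt_coord 1 e).const_sub ε₁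
  have h2 := (hasFDerivAt_coord 2 e).const_sub ε₁
  have h := ((h0.mul h1).mul h2).mul_const (ε₁ - ε₂)⁻¹
  have hfun : secT₁ ε₁ ε₂ = fun e : Fin 3 → ℝ => (e 0 - ε₁) * (ε₁ - e 1) * (ε₁ - e 2) * (ε₁ - ε₂)⁻¹ := by
    funext e; simp [secT₁, div_eq_mul_inv]
  rw [hfun]
  refine h.congr_fderiv ?_
  ext v
  simp [secDeriv_apply, secJac, dotProduct, Fin.sum_univ_three]
  ring

/-- Derivative of `t₂`. [folklore] -/
theorem hasFDerivAt_secT₂ (ε₁ ε₂ : ℝ) (e : Fin 3 → ℝ) :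
    HasFDerivAt (secT₂ ε₁ ε₂) ((ContinuousLinearMap.proj 1).comp (secDeriv ε₁ ε₂ e)) e := by
  have h0 := (hasFDerivAt_coord 0 e).sub_const ε₂
  have h1 := (hasFDerivAt_coord 1 e).sub_const ε₂
  have h2 := (hasFDerivAt_coord 2 e).const_sub ε₂
  have h := ((h0.mul h1).mul h2).mul_const (ε₁ - ε₂)⁻¹
  have hfun : secT₂ ε₁ ε₂ = fun e : Fin 3 → ℝ => (e 0 - ε₂) * (e 1 - ε₂) * (ε₂ - e 2) * (ε₁ - ε₂)⁻¹ := by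
    funext e; simp [secT₂, div_eq_mul_inv]
  rw [hfun]
  refine h.congr_fderiv ?_
  ext v
  simp [secDeriv_apply, secJac, dotProduct, Fin.sum_univ_three]
  ring

/-- Derivative of `d`. [folklore] -/
theorem hasFDerivAt_secD (ε₁ ε₂ : ℝ) (e : Fin 3 → ℝ) :
    HasFDerivAt (secD ε₁ ε₂) ((ContinuousLinearMap.proj 2).comp (secDeriv ε₁ ε₂ e)) e := by
  have h := ((((hasFDerivAt_coord 0 e).add (hasFDerivAt_coord 1 e)).add
    (hasFDerivAt_coord 2 e)).sub_const ε₁).sub_const ε₂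
  have heq : secD ε₁ ε₂ = fun e : Fin 3 → ℝ => e 0 + e 1 + e 2 - ε₁ - ε₂ := rfl
  rw [heq]
  refine h.congr_fderiv ?_
  ext v
  simp [secDeriv_apply, secJac, dotProduct, Fin.sum_univ_three]

/-- **The secular map is differentiable with derivative `secDeriv`.** [folklore] -/
theorem hasFDerivAt_secMap (ε₁ ε₂ : ℝ) (e : Fin 3 → ℝ) :
    HasFDerivAt (secMap ε₁ ε₂) (secDeriv ε₁ ε₂ e) e := by
  rw [hasFDerivAt_pi']
  intro i
  fin_cases i
  · exact hasFDerivAt_secT₁ ε₁ ε₂ e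
  · exact hasFDerivAt_secT₂ ε₁ ε₂ e
  · exact hasFDerivAt_secD ε₁ ε₂ e

/-! ## S6. Injectivity and image of the secular map on the chamber -/

/-- The chamber is an open, hence measurable, set. [folklore] -/
theorem measurableSet_secChamber (ε₁ ε₂ : ℝ) : MeasurableSet (secChamber ε₁ ε₂) := by
  have : secChamber ε₁ ε₂ = {e | ε₁ < e 0} ∩ {e | e 1 < ε₁} ∩ {e | ε₂ < e 1} ∩ {e | e 2 < ε₂} := by
    ext e; simp [secChamber, and_assoc]
  rw [this]
  refine ((MeasurableSet.inter ?_ ?_).inter ?_).inter ?_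
  · exact measurableSet_lt measurable_const (measurable_pi_apply 0)
  · exact measurableSet_lt (measurable_pi_apply 1) measurable_const
  · exact measurableSet_lt measurable_const (measurable_pi_apply 1)
  · exact measurableSet_lt (measurable_pi_apply 2) measurable_const

/-- Two strictly decreasing triples with the same secular coordinates coincide (the secular
coordinates determine the characteristic polynomial, whose sorted roots are the triple).
[folklore] -/
theorem secMap_injOn {ε₁ ε₂ : ℝ} (h : ε₁ ≠ ε₂) :
    Set.InjOn (secMap ε₁ ε₂) (secChamber ε₁ ε₂) := by
  intro e he e' he' hq
  have ha := strictAnti_of_mem_secChamber he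
  have ha' := strictAnti_of_mem_secChamber he'
  have h1 : secT₁ ε₁ ε₂ e = secT₁ ε₁ ε₂ e' := by simpa using congrFun hq 0
  have h2 : secT₂ ε₁ ε₂ e = secT₂ ε₁ ε₂ e' := by simpa using congrFun hq 1
  have h3 : secD ε₁ ε₂ e = secD ε₁ ε₂ e' := by simpa using congrFun hq 2
  have hpoly : ∏ i : Fin 3, (X - C ((e i : ℝ) : ℂ)) = ∏ i : Fin 3, (X - C ((e' i : ℝ) : ℂ)) := by
    rw [← secular_identity h e, ← secular_identity h e', h1, h2, h3]
  have hroots : (Finset.univ.val.map fun i : Fin 3 => ((e i : ℝ) : ℂ)) =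
      Finset.univ.val.map fun i : Fin 3 => ((e' i : ℝ) : ℂ) := by
    have key : ∀ f : Fin 3 → ℝ, (∏ i : Fin 3, (X - C ((f i : ℝ) : ℂ))).roots =
        Finset.univ.val.map fun i : Fin 3 => ((f i : ℝ) : ℂ) := by
      intro f
      rw [Finset.prod_eq_multiset_prod,
        show Finset.univ.val.map (fun i : Fin 3 => X - C ((f i : ℝ) : ℂ)) =
          (Finset.univ.val.map fun i : Fin 3 => ((f i : ℝ) : ℂ)).map (fun a => X - C a) by
            rw [Multiset.map_map]; rfl,
        Polynomial.roots_multiset_prod_X_sub_C]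
    rw [← key e, ← key e', hpoly]
  have hre : ∀ f : Fin 3 → ℝ, (Finset.univ.val.map fun i : Fin 3 => ((f i : ℝ) : ℂ)).map Complex.re =
      ((List.ofFn f : List ℝ) : Multiset ℝ) := by
    intro f
    rw [Fin.univ_val_map, Multiset.map_coe, List.map_ofFn]
    congr 1
  have hlists : ((List.ofFn e : List ℝ) : Multiset ℝ) = (List.ofFn e' : List ℝ) := by
    rw [← hre e, ← hre e', hroots]
  have hperm : (List.ofFn e).Perm (List.ofFn e') := Quotient.exact hlists
  have hsorted : ∀ f : Fin 3 → ℝ, StrictAnti f → (List.ofFn f).SortedGE := fun f hf =>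
    List.sortedGE_iff_pairwise.mpr (List.pairwise_ofFn.mpr fun i j hij => (hf hij).le)
  have heq : List.ofFn e = List.ofFn e' :=
    hperm.eq_of_sortedGE (hsorted e ha) (hsorted e' ha')
  exact List.ofFn_injective heq

/-- Pointwise (real) form of the secular identity. [folklore] -/
theorem secular_identity_eval {ε₁ ε₂ : ℝ} (h : ε₁ ≠ ε₂) (e : Fin 3 → ℝ) (z : ℝ) :
    (z - ε₁) * (z - ε₂) * (z - secD ε₁ ε₂ e) - secT₁ ε₁ ε₂ e * (z - ε₂) - secT₂ ε₁ ε₂ e * (z - ε₁) =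
      (z - e 0) * (z - e 1) * (z - e 2) := by
  have h12 : ε₁ - ε₂ ≠ 0 := sub_ne_zero.mpr h
  unfold secD secT₁ secT₂
  field_simp
  ring

/-- **The image of the chamber is the open quadrant `t₁ > 0, t₂ > 0` (times `ℝ`)**: every bordered
matrix datum `(t₁, t₂, d)` with `tᵢ > 0` comes from a unique strictly interlacing spectrum (three
sign changes of the secular cubic and the intermediate value theorem). [folklore] -/
theorem image_secMap {ε₁ ε₂ : ℝ} (hε : ε₂ < ε₁) :
    secMap ε₁ ε₂ '' secChamber ε₁ ε₂ = {q : Fin 3 → ℝ | 0 < q 0 ∧ 0 < q 1} := by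
  ext q
  constructor
  · rintro ⟨e, he, rfl⟩
    exact ⟨secT₁_pos he, secT₂_pos he⟩
  rintro ⟨hq0, hq1⟩
  set t₁ := q 0
  set t₂ := q 1
  set d := q 2
  -- the secular cubic
  set p : ℝ → ℝ := fun z => (z - ε₁) * (z - ε₂) * (z - d) - t₁ * (z - ε₂) - t₂ * (z - ε₁) with hp
  have hpc : Continuous p := by rw [hp]; fun_prop
  have hk : 0 < ε₁ - ε₂ := sub_pos.mpr hε
  have hp1 : p ε₁ < 0 := by simp only [hp]; nlinarith
  have hp2 : 0 < p ε₂ := by simp only [hp]; nlinarith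
  set M := max (max ε₁ ε₂) d + 1 + t₁ + t₂ with hM
  set N := min (min ε₁ ε₂) d - 1 - t₁ - t₂ with hN
  have hM1 : 1 + t₁ + t₂ ≤ M - ε₁ := by
    have := le_max_left (max ε₁ ε₂) d; have := le_max_left ε₁ ε₂; linarith
  have hM2 : 1 + t₁ + t₂ ≤ M - ε₂ := by
    have := le_max_left (max ε₁ ε₂) d; have := le_max_right ε₁ ε₂; linarith
  have hM3 : 1 + t₁ + t₂ ≤ M - d := by
    have := le_max_right (max ε₁ ε₂) d; linarith
  have hpM : 0 < p M := by
    simp only [hp]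
    have a1 : 0 < M - ε₁ := by linarith
    have a2 : 0 < M - ε₂ := by linarith
    have e1 : t₁ * (M - ε₂) ≤ t₁ * ((M - ε₂) * (M - ε₁)) := by
      apply mul_le_mul_of_nonneg_left _ hq0.le; nlinarith
    have e2 : t₂ * (M - ε₁) ≤ t₂ * ((M - ε₁) * (M - ε₂)) := by
      apply mul_le_mul_of_nonneg_left _ hq1.le; nlinarith
    have e3 : (M - ε₁) * (M - ε₂) * (1 + t₁ + t₂) ≤ (M - ε₁) * (M - ε₂) * (M - d) :=
      mul_le_mul_of_nonneg_left hM3 (by positivity)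
    nlinarith [mul_pos a1 a2]
  have hN1 : 1 + t₁ + t₂ ≤ ε₁ - N := by
    have := min_le_left (min ε₁ ε₂) d; have := min_le_left ε₁ ε₂; linarith
  have hN2 : 1 + t₁ + t₂ ≤ ε₂ - N := by
    have := min_le_left (min ε₁ ε₂) d; have := min_le_right ε₁ ε₂; linarith
  have hN3 : 1 + t₁ + t₂ ≤ d - N := by
    have := min_le_right (min ε₁ ε₂) d; linarith
  have hpN : p N < 0 := by
    simp only [hp]
    have a1 : 0 < ε₁ - N := by linarith
    have a2 : 0 < ε₂ - N := by linarith
    have e1 : t₁ * (ε₂ - N) ≤ t₁ * ((ε₂ - N) * (ε₁ - N)) := by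
      apply mul_le_mul_of_nonneg_left _ hq0.le; nlinarith
    have e2 : t₂ * (ε₁ - N) ≤ t₂ * ((ε₁ - N) * (ε₂ - N)) := by
      apply mul_le_mul_of_nonneg_left _ hq1.le; nlinarith
    have e3 : (ε₁ - N) * (ε₂ - N) * (1 + t₁ + t₂) ≤ (ε₁ - N) * (ε₂ - N) * (d - N) :=
      mul_le_mul_of_nonneg_left hN3 (by positivity)
    nlinarith [mul_pos a1 a2]
  have hεM : ε₁ ≤ M := by linarith
  have hNε : N ≤ ε₂ := by linarith
  -- three roots by the intermediate value theorem
  obtain ⟨r₀, hr₀, hpr₀⟩ : ∃ r ∈ Set.Ioo ε₁ M, p r = 0 :=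
    intermediate_value_Ioo hεM hpc.continuousOn ⟨hp1, hpM⟩
  obtain ⟨r₁, hr₁, hpr₁⟩ : ∃ r ∈ Set.Ioo ε₂ ε₁, p r = 0 :=
    intermediate_value_Ioo' hε.le hpc.continuousOn ⟨hp1, hp2⟩
  obtain ⟨r₂, hr₂, hpr₂⟩ : ∃ r ∈ Set.Ioo N ε₂, p r = 0 :=
    intermediate_value_Ioo hNε hpc.continuousOn ⟨hpN, hp2⟩
  set e : Fin 3 → ℝ := ![r₀, r₁, r₂] with he_def
  have he : e ∈ secChamber ε₁ ε₂ := ⟨hr₀.1, hr₁.2, hr₁.1, hr₂.2⟩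
  refine ⟨e, he, ?_⟩
  -- the quadratic `p − ∏ (z − rᵢ)` has the three distinct roots `rᵢ`, hence vanishes
  set α := secD ε₁ ε₂ e - d with hα
  set β₁ := t₁ - secT₁ ε₁ ε₂ e with hβ₁
  set β₂ := t₂ - secT₂ ε₁ ε₂ e with hβ₂
  have hq : ∀ z, p z - (z - e 0) * (z - e 1) * (z - e 2) =
      α * ((z - ε₁) * (z - ε₂)) - β₁ * (z - ε₂) - β₂ * (z - ε₁) := by
    intro z
    rw [← secular_identity_eval hε.ne' e z]
    simp only [hp, hα, hβ₁, hβ₂]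
    ring
  have he0 : e 0 = r₀ := rfl
  have he1 : e 1 = r₁ := rfl
  have he2 : e 2 = r₂ := rfl
  have hz0 : α * ((r₀ - ε₁) * (r₀ - ε₂)) - β₁ * (r₀ - ε₂) - β₂ * (r₀ - ε₁) = 0 := by
    rw [← hq, hpr₀, he0, he1, he2]; ring
  have hz1 : α * ((r₁ - ε₁) * (r₁ - ε₂)) - β₁ * (r₁ - ε₂) - β₂ * (r₁ - ε₁) = 0 := by
    rw [← hq, hpr₁, he0, he1, he2]; ring
  have hz2 : α * ((r₂ - ε₁) * (r₂ - ε₂)) - β₁ * (r₂ - ε₂) - β₂ * (r₂ - ε₁) = 0 := by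
    rw [← hq, hpr₂, he0, he1, he2]; ring
  have h01 : r₀ - r₁ ≠ 0 := by have := hr₁.2; have := hr₀.1; linarith
  have h12 : r₁ - r₂ ≠ 0 := by have := hr₂.2; have := hr₁.1; linarith
  have h02 : r₀ - r₂ ≠ 0 := by have := hr₂.2; have := hr₁.1; have := hr₁.2; have := hr₀.1; linarith
  have hαz : α * ((r₀ - r₁) * (r₁ - r₂) * (r₀ - r₂)) = 0 := by
    linear_combination (r₁ - r₂) * hz0 - (r₁ - r₂) * hz1 - (r₀ - r₁) * hz1 + (r₀ - r₁) * hz2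
  have hα0 : α = 0 := by
    rcases mul_eq_zero.mp hαz with h | h
    · exact h
    · exfalso; exact mul_ne_zero (mul_ne_zero h01 h12) h02 h
  have hβs : (β₁ + β₂) * (r₀ - r₁) = 0 := by
    linear_combination (-1 : ℝ) * hz0 + hz1 + ((r₀ - ε₁) * (r₀ - ε₂) - (r₁ - ε₁) * (r₁ - ε₂)) * hα0
  have hβs' : β₁ + β₂ = 0 := by
    rcases mul_eq_zero.mp hβs with h | h
    · exact h
    · exact absurd h h01
  have hβ1z : β₁ * (ε₂ - ε₁) = 0 := by
    have h' := hz0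
    rw [hα0, show β₂ = -β₁ by linarith] at h'
    linear_combination h'
  have hβ10 : β₁ = 0 := by
    rcases mul_eq_zero.mp hβ1z with h | h
    · exact h
    · exfalso; linarith
  have hβ20 : β₂ = 0 := by linarith
  funext i
  fin_cases i
  · show secT₁ ε₁ ε₂ e = q 0
    have : β₁ = q 0 - secT₁ ε₁ ε₂ e := rfl
    linarith
  · show secT₂ ε₁ ε₂ e = q 1
    have : β₂ = q 1 - secT₂ ε₁ ε₂ e := rfl
    linarith
  · show secD ε₁ ε₂ e = q 2
    have : α = secD ε₁ ε₂ e - q 2 := rfl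
    linarith

/-! ## S7. The change of variables -/

open MeasureTheory in
/-- **Secular change of variables.** For `ε₂ < ε₁` and any `g ≥ 0`:
`∫_{t₁>0, t₂>0, d} g(t₁, t₂, d) = ∫_{e₀>ε₁>e₁>ε₂>e₂} Δ(e)/(ε₁−ε₂) · g(t₁(e), t₂(e), d(e)) de`,
`Δ(e) = (e₀−e₁)(e₀−e₂)(e₁−e₂)` — the rank-one (bordering) instance of the Weyl/Gelfand–Tsetlin
Jacobian, obtained here from Mathlib's change-of-variables theorem for the polynomial
diffeomorphism `Θ`. [folklore] -/
theorem lintegral_comp_secMap {ε₁ ε₂ : ℝ} (hε : ε₂ < ε₁) (g : (Fin 3 → ℝ) → ENNReal) :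
    ∫⁻ q in {q : Fin 3 → ℝ | 0 < q 0 ∧ 0 < q 1}, g q =
      ∫⁻ e in secChamber ε₁ ε₂,
        ENNReal.ofReal ((e 0 - e 1) * (e 0 - e 2) * (e 1 - e 2) / (ε₁ - ε₂)) *
          g (secMap ε₁ ε₂ e) := by
  rw [← image_secMap hε,
    lintegral_image_eq_lintegral_abs_det_fderiv_mul volume (measurableSet_secChamber ε₁ ε₂)
      (fun e _ => (hasFDerivAt_secMap ε₁ ε₂ e).hasFDerivWithinAt) (secMap_injOn hε.ne') g]
  refine setLIntegral_congr_fun (measurableSet_secChamber ε₁ ε₂) ?_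
  intro e he
  dsimp only
  rw [det_secDeriv hε.ne' e, abs_of_pos]
  obtain ⟨h0, h1, h2, h3⟩ := he
  have a : 0 < e 0 - e 1 := by linarith
  have b : 0 < e 0 - e 2 := by linarith
  have c : 0 < e 1 - e 2 := by linarith
  have k : 0 < ε₁ - ε₂ := by linarith
  positivity

end ZhangJiangXie2025

end Literature.Probability.RandomMatrix

end
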